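import Literature.AlgebraicGeometry.ShimuraVarieties.UnitaryBallSpecialCycleAnalytic
import Literature.NumberTheory.Automorphic.PicardCMPrerequisites
import Literature.AlgebraicGeometry.HodgeTheory.LefschetzOneOneChowProofs
import Literature.AlgebraicGeometry.HodgeTheory.GAGADimensionProofs
import HarnessLib

/-!
# `PicardCM.SpecialCyclesAlgebraic` holds: special cycles of compact ball quotients are algebraic

Topic `NumberTheory/Automorphic`; namespace `Literature.NumberTheory.Automorphic`. **No named facts,
no `sorry`**, imports = tree only.

The record (ii-b) `PicardCM.SpecialCyclesAlgebraic` of `PicardCMPrerequisites` — Kudla–Millson,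
Publ. Math. IHÉS 71 (1990), Lemma 1.1 p. 128 ("Suppose `Γ` is arithmetic and `G₁` is defined over `ℚ`.
Then `j₁` is a proper embedding onto a totally geodesic submanifold of `M`") and p. 133 ("In case
`G = U(p, q)`, the cycle `C_β` is an algebraic cycle"); Bergeron–Millson–Moeglin, Acta Math. 216 (2016),
Introduction §1.7 (special cycles of complex codimension `nq` in `S = Γ\𝔹`) — is PROVED here, for
every compact arithmetic ball quotient `unif : Γ\𝔹² ≅ X(ℂ)` as in the record (CM field `E ⊆ ℂ`,
hermitian `H ∈ M₃(E)` of signature `(2,1)` at the distinguished place and definite elsewhere,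
torsion-free congruence subgroup `Γ`, `X/ℂ` smooth projective, `unif` a ball uniformisation) and EVERY
`E`-subspace `W ⊆ E³`: the image under `unif` of the sub-ball `𝔹(W^⊥)` is the set of complex points of a
Zariski-closed `Z ⊆ X` all of whose scheme points have codimension `≥ dim_E W`.

PROOF (`PicardCM.specialCyclesAlgebraic_holds`). Package the hypotheses as a
`UnitaryBallUniformisationDatum 2 X` and fix a Sylvester frame. The compact complex surface
`S(Γ) = Δ\𝔹²` (`UnitaryBallQuotientSurface`) is the analytification of `X`
(`isAnalytification_quotientSurface`), and on it the special cycle of `W` is a closed ANALYTIC subset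
whose regular points all have codimension `≥ dim_E W` (`UnitaryBallSpecialCycleAnalytic`:
`isAnalyticSet_specialCycle`, `finrank_le_of_mem_regularLocus` — resting on the arithmetic local
finiteness of the `Γ`-translates of `𝔹(W^⊥)`, `UnitaryBallSpecialCycleFinite`, i.e. Kudla–Millson's
"`j₁` is proper"). CHOW'S THEOREM for analytifications of smooth projective varieties
(`Literature.AlgebraicGeometry.HodgeTheory.chow_analyticSet_analytification_holds`, Serre GAGA §19
Prop. 13 / Chow 1949 Thm. V, proved in the tree) gives the Zariski-closed `Z` with the right complex
points, and the GAGA DIMENSION COMPARISON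
(`Literature.AlgebraicGeometry.HodgeTheory.gaga_le_coheight_of_regularLocus_codim_holds`, Serre GAGA
§6 Prop. 3 Cor. 2–3, proved in the tree) turns the analytic codimension bound into
`dim_E W ≤ coheight z` for every scheme point `z ∈ Z`. The total-positivity hypothesis on `W` is not
needed (for other `W` the sub-ball is empty or degenerate and the same proof applies).

With (ii-a) `BallQuotientUniformised`, (i), (iii), (iv) already theorems, this closes the last
record of the Picard–CM prerequisite bundle (`PicardCM.ballQuotientAlgebraic_of`; the hypothesis-free
corollaries are drawn where (ii-a)'s proof lives, `Summits/HodgeConjecture/CorCM/Geometry`).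

## References

* S. Kudla, J. Millson, *Intersection numbers of cycles on locally symmetric spaces and Fourier
  coefficients of holomorphic modular forms in several complex variables*, Publ. Math. IHÉS 71 (1990),
  Lemma 1.1 p. 128 and p. 133. [KudlaMillson1990]
* N. Bergeron, J. Millson, C. Moeglin, *The Hodge conjecture and arithmetic quotients of complex
  balls*, Acta Math. 216 (2016), Introduction §1.7, Part 2 §§3.2–3.3. [BergeronMillsonMoeglin2016Balls]
* J.-P. Serre, *Géométrie algébrique et géométrie analytique*, Ann. Inst. Fourier 6 (1956), §6 Prop. 3
  Cor. 2–3, §19 Prop. 13 (tree: `chow_analyticSet_analytification_holds`,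
  `gaga_le_coheight_of_regularLocus_codim_holds`). [SerreGAGA1956]

## Provenance

Written for the pub-hodgecm2 (COR-CM) cell, lane SPECIAL-CYCLES (seat b06): the discharge of the record.
Nothing in this file is a claim of the manuscripts adjudicated by that cell.
-/

set_option autoImplicit false

noncomputable section

open scoped Manifold ContDiff
open Literature.AlgebraicGeometry.ShimuraVarieties Literature.AlgebraicGeometry.HodgeTheory

namespace Literature.NumberTheory.Automorphic

namespace PicardCM

open Literature.AlgebraicGeometry.Motives (SchemeOver ComplexPoints IsSmoothProjective)

/-- **Kudla–Millson / Bergeron–Millson–Moeglin: special cycles of compact arithmetic ball quotients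
are closed algebraic subvarieties of codimension `≥ dim_E W` — the record
`PicardCM.SpecialCyclesAlgebraic` HOLDS.** For `(E, H, Γ, X, unif)` as in the record and any
`E`-subspace `W ⊆ E³`, `unif '' 𝔹(W^⊥)` is the set of complex points of a Zariski-closed `Z ⊆ X` with
`dim_E W ≤ coheight z` for all `z ∈ Z` (the special cycle on `S(Γ) = X^an` is a closed analytic subset
with regular points of codimension `≥ dim_E W`; Chow's theorem and the GAGA dimension comparison).
[cite: KudlaMillson1990, Lemma 1.1, p. 128 and p. 133]
[cite: BergeronMillsonMoeglin2016Balls, Introduction §1.7; Part 2 §3.2] -/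
theorem specialCyclesAlgebraic_holds : SpecialCyclesAlgebraic := by
  intro E _ _ H Γ X unif hH han hsig hpos hcong htf hX hU W _
  -- the datum and a Sylvester frame
  let D : UnitaryBallUniformisationDatum 2 X :=
    { E := E, H := H, conj_H_apply := hH, anisotropic := han, signature_τ₁ := hsig,
      posDef_of_ne := hpos, Γ := Γ, isCongruenceSubgroup := hcong, torsionFree := htf, unif := unif,
      continuousOn_unif := hU.1, isOpenMap_unif := hU.2.1, surjOn_unif := hU.2.2.1,
      unif_eq_unif_iff := hU.2.2.2.1, differentiableOn_unif := hU.2.2.2.2,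
      isSmoothProjective := hX }
  obtain ⟨𝔣⟩ := D.nonempty_sylvesterFrame
  -- `S(Γ) ≃ X(ℂ)` is the analytification; the special cycle on it is analytic
  have hφ := D.isAnalytification_quotientSurface 𝔣
  have hS : Literature.Geometry.Kaehler.IsAnalyticSet 𝓘(ℂ, Fin 2 → ℂ) (D.specialCycle 𝔣 W) :=
    D.isAnalyticSet_specialCycle 𝔣 W
  -- Chow
  obtain ⟨Z, hZc, hZeq⟩ := chow_analyticSet_analytification_holds hX hφ (D.specialCycle 𝔣 W) hS
  refine ⟨Z, hZc, fun P ↦ ?_, ?_⟩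
  · -- the complex points of `Z` are the images of the sub-ball
    have himg : unif '' subCone (H.map E.subtype) ((fun w ↦ E.subtype ∘ w) '' (W : Set (Fin 3 → E))) =
        D.ballUnifMap 𝔣 '' D.specialBall 𝔣 (W : Set (Fin 3 → E)) :=
      D.image_unif_subCone_eq 𝔣 (W : Set (Fin 3 → E))
    set m := (D.quotientSurfaceHomeomorph 𝔣).symm P with hm
    have hP : D.quotientSurfaceHomeomorph 𝔣 m = P := (D.quotientSurfaceHomeomorph 𝔣).apply_symm_apply P
    have key : P.pt ∈ Z ↔ m ∈ D.specialCycle 𝔣 W := by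
      rw [hZeq, Set.mem_preimage, hP, Set.mem_setOf_eq]
    rw [key, ← D.preimage_quotientSurfaceHomeomorph_image_specialBall 𝔣 W, Set.mem_preimage, hP, himg]
  · -- codimension, by the GAGA dimension comparison
    refine gaga_le_coheight_of_regularLocus_codim_holds hX hφ (Module.finrank E W) Z hZc ?_
    rw [← hZeq]
    exact D.finrank_le_of_mem_regularLocus 𝔣 W

end PicardCM

end Literature.NumberTheory.Automorphic

end
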